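import Mathlib
import Literature.Computability.Complexity.CliqueTestGraphs
import Literature.GroupTheory.PermutationGroups.SmallIndexSubgroups
import Summits.PneNP.PneNP.Theorems.ConvexRankGatesConvexGateBlindSymmetricGate
import Summits.PneNP.PneNP.Theorems.ConvexRankGatesConvexGateBlindSmallJunta

/-!
# PneNP / ConvexRankGates — `ConvexGateBlind`: symmetric LP row objects must break the symmetry of `O(⌈m^δ⌉)`-blocks

Helpers (`--supports stmt-PneNP-10680`). `…SymmetricBlind.lean` / `…SymmetricHard.lean` / `…SymmetricGate.lean` with the
SMALL-CLASS junta theorem of `…SmallJunta.lean` plugged in. Fixed `m` (`cdist_colorVec_not_symmetricRep_small`, registered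
stub `symmetric_blind_small`): for a balanced `K`-colouring column with classes of size `n ≥ t + 1` (`2 ≤ t`, `t + 1 ≤ K`),
`8 < m`, `4(t+1) ≤ m`, every symmetric family of non-negative row objects with `#L < C(m, t+1)` fails
`cdist Q (colorVec h) - ε = ∑_l c_l V_l(Q)` for every `ε > 0`. Eventual form
(`symmetric_cliqueDistConeRankHard_smallBlock`, stub `symmetric_crux_smallblock`): for EVERY `δ ∈ (0,1)`, every `c` and every
`t ≥ max(2, 2⌈1/δ⌉c)`, eventually in `m` (`k = ⌈m^δ⌉₊`), a family of `≤ m^c` non-negative row objects that is symmetric under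
the vertex permutations fixing every vertex `≥ (k-1)(t+1)` fails the canonical identity of the crux for every `ε > 0` — the block
of `…SymmetricHard.lean` had `k² - 1` vertices, now `O_{c,δ}(k)`: colour the first `(k-1)(t+1)` vertices with `k-1` classes of
size `t+1` and use `m^c ≤ k^{⌈1/δ⌉c} ≤ (k-1)^{2⌈1/δ⌉c} < (k-1)^{t+1} ≤ C((k-1)(t+1), t+1)`. Gate form
(`symmetric_lpGate_blind_smallBlock`, stub `symmetric_gate_smallblock`): no single monotone LP gate with `p + q ≤ m^c` whose data
is invariant under a permutation representation of that group computes `CLIQUE(m, ⌈m^δ⌉₊)` (`t ≥ max(2, 2⌈1/δ⌉(c+3))`). So a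
polynomial-size monotone LP gate / LP certificate family for CLIQUE must break the symmetry of EVERY vertex block of size
`Θ_{c,δ}(m^δ)` — the scale of the clique itself. [new]
-/

set_option linter.dupNamespace false

namespace Summit.PneNP.PneNP.Theorems

open Finset Filter Literature.Computability.Complexity
open Summit.PneNP.PneNP.Cruxes.ConvexGateBlind.StrictRankConicCover (Edge cdist padRow padCol liveEmb
  cdist_pad cliqueFn_padCol card_padRow)

noncomputable section

variable {m : ℕ}

/-! ## Symmetric certificates are blind once the classes have size `t + 2` -/

/-- **`Alt`-stabiliser-invariant non-negative certificates are blind (classes of size `t + 1`).** As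
`cdist_colorVec_not_altStabInvariantRep_sharp`, with the class-size hypothesis `n ≥ K + 1` replaced by `n ≥ t + 1`
(`2 ≤ t`, `t + 1 ≤ K`, `#W_l ≤ t`). [new] -/
theorem cdist_colorVec_not_altStabInvariantRep_small {K : ℕ} (h : Fin m → Fin K) {n t : ℕ}
    (hn : ∀ c, (cls h c).card = n) (ht2 : 2 ≤ t) (htK : t + 1 ≤ K) (htn : t + 1 ≤ n) {ε : ℝ} (hε : 0 < ε)
    {ι : Type*} [Fintype ι] (W : ι → Finset (Fin m)) (hW : ∀ l, (W l).card ≤ t) (V : ι → Finset (Fin m) → ℝ)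
    (hV0 : ∀ l Q, Q.card = K + 1 → 0 ≤ V l Q)
    (hV : ∀ l (σ : Equiv.Perm (Fin m)), Equiv.Perm.sign σ = 1 → (∀ w ∈ W l, σ w = w) →
      ∀ Q : Finset (Fin m), Q.card = K + 1 → V l (Q.map σ.toEmbedding) = V l Q) :
    ¬ ∀ Q : Finset (Fin m), Q.card = K + 1 → cdist Q (colorVec h) - ε = ∑ l, V l Q := by
  classical
  intro hrep
  let F : ι → Finset (Fin m) → ℝ := fun l P =>
    if hP : ∃ Q : Finset (Fin m), Q.card = K + 1 ∧ Q ∩ W l = P then V l hP.choose else 0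
  have hF : ∀ l (Q : Finset (Fin m)), Q.card = K + 1 → V l Q = F l (Q ∩ W l) := by
    intro l Q hQ
    have hP : ∃ Q' : Finset (Fin m), Q'.card = K + 1 ∧ Q' ∩ W l = Q ∩ W l := ⟨Q, hQ, rfl⟩
    simp only [F, dif_pos hP]
    have hcW : (W l).card + 2 ≤ K + 1 := by have := hW l; omega
    exact eq_of_altStabiliserInvariant (V l) (W l) hcW (hV l) _ Q hP.choose le_rfl hQ hP.choose_spec.1
      hP.choose_spec.2.symm
  refine cdist_colorVec_not_juntaRep_small h hn ht2 htK htn hε W F hW ?_ ?_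
  · intro l P
    simp only [F]
    split_ifs with hP
    · exact hV0 l _ hP.choose_spec.1
    · exact le_refl _
  · intro Q hQ
    rw [hrep Q hQ]
    exact Finset.sum_congr rfl fun l _ => hF l Q hQ

/-- **Symmetric non-negative certificates are ε-exactly blind on colouring columns with classes of size `t + 1`
(unconditional).** Let `h` be a balanced `K`-colouring of `Fin m` with classes of size `n ≥ t + 1`, `2 ≤ t`, `t + 1 ≤ K`,
`8 < m`, `4(t+1) ≤ m`; let `(V_l)_{l ∈ L}` be a `Sym(m)`-symmetric family of functions on vertex sets
(`V_{τ σ l}(σ Q) = V_l(Q)`), non-negative on `(K+1)`-sets, with `#L < C(m, t+1)`. Then for every `ε > 0` and all `c_l ≥ 0`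
there is NO identity `cdist Q (colorVec h) - ε = ∑_l c_l V_l(Q)` on the `(K+1)`-sets (Dixon–Mortimer 5.2B + the even
permutation junta lemma + `cdist_colorVec_not_juntaRep_small`). [new] -/
theorem cdist_colorVec_not_symmetricRep_small {K : ℕ} (h : Fin m → Fin K) {n t : ℕ} (hn : ∀ c, (cls h c).card = n)
    (ht2 : 2 ≤ t) (htK : t + 1 ≤ K) (htn : t + 1 ≤ n) (hm8 : 8 < m) (h4t : 4 * (t + 1) ≤ m)
    {ε : ℝ} (hε : 0 < ε) {L : Type*} [Fintype L] (hL : Fintype.card L < m.choose (t + 1))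
    (V : Finset (Fin m) → L → ℝ) (τ : Equiv.Perm (Fin m) → L → L)
    (hτ : ∀ σ l Q, V (Q.map σ.toEmbedding) (τ σ l) = V Q l)
    (hV0 : ∀ l Q, Q.card = K + 1 → 0 ≤ V Q l) (c : L → ℝ) (hc : ∀ l, 0 ≤ c l) :
    ¬ ∀ Q : Finset (Fin m), Q.card = K + 1 → cdist Q (colorVec h) - ε = ∑ l, c l * V Q l := by
  classical
  intro hrep
  have hstab : ∀ l, ∃ X : Finset (Fin m), X.card ≤ t ∧ ∀ ρ : Equiv.Perm (Fin m), Equiv.Perm.sign ρ = 1 →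
      (∀ x ∈ X, ρ x = x) → ∀ Q : Finset (Fin m), V (Q.map ρ.toEmbedding) l = V Q l := by
    intro l
    obtain ⟨H, hH, hidx⟩ := XorDoor.exists_stabilizer_index_le (G := Equiv.Perm (Fin m))
      (A := Finset (Fin m)) (fun σ Q => Q.map σ.toEmbedding)
      (fun Q => by
        show Q.map (1 : Equiv.Perm (Fin m)).toEmbedding = Q
        rw [Equiv.Perm.one_def, Equiv.refl_toEmbedding, Finset.map_refl])
      (fun g g' Q => by
        show Q.map (g * g').toEmbedding = (Q.map g'.toEmbedding).map g.toEmbedding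
        rw [Equiv.Perm.mul_def, Equiv.trans_toEmbedding, Finset.map_map])
      V τ hτ l
    have hidx' : H.index < (Fintype.card (Fin m)).choose (t + 1) := by
      rw [Fintype.card_fin]; exact lt_of_le_of_lt hidx hL
    obtain ⟨X, hXcard, hX⟩ :=
      Literature.GroupTheory.PermutationGroups.alternating_fixing_le_of_index_lt_choose H (t + 1)
        (by rw [Fintype.card_fin]; exact hm8) (Nat.succ_pos t) (by rw [Fintype.card_fin]; exact h4t) hidx'
    exact ⟨X, by omega, fun ρ hsign hfix Q => (hH ρ).1 (hX ρ hfix hsign) Q⟩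
  choose X hXt hXinv using hstab
  refine cdist_colorVec_not_altStabInvariantRep_small h hn ht2 htK htn hε X hXt (fun l Q => c l * V Q l) ?_ ?_ ?_
  · intro l Q hQ
    exact mul_nonneg (hc l) (hV0 l Q hQ)
  · intro l σ hsign hfix Q _
    show c l * V (Q.map σ.toEmbedding) l = c l * V Q l
    rw [hXinv l σ hsign hfix Q]
  · intro Q hQ
    rw [hrep Q hQ]

/-! ## Eventually the block of `(k-1)(t+1)` vertices fits -/

/-- For `0 < δ < 1` and any `B`: eventually `B ≤ ⌈m^δ⌉₊` and `B · ⌈m^δ⌉₊ ≤ m`. -/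
theorem eventually_ceil_rpow_ge_and_mul_le {δ : ℝ} (hδ0 : 0 < δ) (hδ1 : δ < 1) (B : ℕ) :
    ∀ᶠ m : ℕ in atTop, B ≤ ⌈(m : ℝ) ^ δ⌉₊ ∧ B * ⌈(m : ℝ) ^ δ⌉₊ ≤ m := by
  have hx : Tendsto (fun m : ℕ => (m : ℝ) ^ δ) atTop atTop :=
    (tendsto_rpow_atTop hδ0).comp tendsto_natCast_atTop_atTop
  have hceil : Tendsto (fun m : ℕ => ⌈(m : ℝ) ^ δ⌉₊) atTop atTop := tendsto_nat_ceil_atTop.comp hx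
  have hy : Tendsto (fun m : ℕ => (m : ℝ) ^ (1 - δ)) atTop atTop :=
    (tendsto_rpow_atTop (by linarith)).comp tendsto_natCast_atTop_atTop
  filter_upwards [hceil.eventually_ge_atTop B, hy.eventually_ge_atTop (2 * (B : ℝ)), eventually_ge_atTop 1]
    with m hB hy1 hm1
  refine ⟨hB, ?_⟩
  have hm0 : (0 : ℝ) < m := by exact_mod_cast hm1
  have hxge1 : (1 : ℝ) ≤ (m : ℝ) ^ δ := Real.one_le_rpow (by exact_mod_cast hm1) hδ0.le
  have hceil_le : (⌈(m : ℝ) ^ δ⌉₊ : ℝ) ≤ 2 * (m : ℝ) ^ δ := by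
    have := Nat.ceil_lt_add_one (by positivity : (0 : ℝ) ≤ (m : ℝ) ^ δ)
    linarith
  have hB0 : (0 : ℝ) ≤ B := Nat.cast_nonneg _
  have hy1' : 2 * (B : ℝ) ≤ (m : ℝ) ^ (1 - δ) := hy1
  have key : (B : ℝ) * ⌈(m : ℝ) ^ δ⌉₊ ≤ m := by
    calc (B : ℝ) * ⌈(m : ℝ) ^ δ⌉₊ ≤ (B : ℝ) * (2 * (m : ℝ) ^ δ) := mul_le_mul_of_nonneg_left hceil_le hB0
      _ = (2 * (B : ℝ)) * (m : ℝ) ^ δ := by ring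
      _ ≤ (m : ℝ) ^ (1 - δ) * (m : ℝ) ^ δ := mul_le_mul_of_nonneg_right hy1' (by positivity)
      _ = m := by rw [← Real.rpow_add hm0, sub_add_cancel, Real.rpow_one]
  exact_mod_cast key

/-! ## The LP slice of the crux holds for families symmetric on a block of `(k-1)(t+1)` vertices -/

/-- **The LP slice of the crux holds for every family of row objects that is symmetric on the first `(k-1)(t+1)` vertices
(every `δ ∈ (0,1)`, every `c`, every `t ≥ max(2, 2⌈1/δ⌉c)`).** Eventually in `m` (`k = ⌈m^δ⌉₊`), for every `ε > 0`, every
index type `L` with `#L ≤ m^c`, every `U ≥ 0`, and every family `(V_l)_{l ∈ L}` of non-negative row objects that is symmetric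
under the vertex permutations FIXING EVERY VERTEX `v ≥ (k-1)(t+1)`, the canonical identity `cdist Q u - ε = ∑_l U_{u,l} V_l(Q)`
fails for some `k`-set `Q` and some `k`-clique-free `u`. So a polynomial-size monotone LP certificate family for `CLIQUE(m, m^δ)`
must break the symmetry of EVERY vertex block of size `(k-1)(t+1) = Θ_{c,δ}(m^δ)` (by conjugation, any such block). Proof:
colour the block with `k - 1` classes of size `t + 1`, transport family and symmetry along the block embedding
(`Equiv.Perm.extendDomain`), apply `cdist_colorVec_not_symmetricRep_small`, and count
`m^c ≤ k^{⌈1/δ⌉c} ≤ (k-1)^{2⌈1/δ⌉c} < (k-1)^{t+1} ≤ C((k-1)(t+1), t+1)`. [new] -/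
theorem symmetric_cliqueDistConeRankHard_smallBlock {δ : ℝ} (hδ0 : 0 < δ) (hδ1 : δ < 1) (c t : ℕ) (ht2 : 2 ≤ t)
    (hct : 2 * (⌈1 / δ⌉₊ * c) ≤ t) :
    ∀ᶠ m : ℕ in atTop, ∀ ε : ℝ, 0 < ε → ∀ (L : Type) [Fintype L], Fintype.card L ≤ m ^ c →
      ∀ (U : (Edge m → Bool) → L → ℝ) (V : L → Finset (Fin m) → ℝ) (τ : Equiv.Perm (Fin m) → L → L),
      (∀ σ : Equiv.Perm (Fin m), (∀ v : Fin m, (⌈(m : ℝ) ^ δ⌉₊ - 1) * (t + 1) ≤ v.val → σ v = v) →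
        ∀ l Q, V (τ σ l) (Q.map σ.toEmbedding) = V l Q) →
      (∀ u l, 0 ≤ U u l) → (∀ l Q, 0 ≤ V l Q) →
      ¬ ∀ (Q : Finset (Fin m)) (u : Edge m → Bool), Q.card = ⌈(m : ℝ) ^ δ⌉₊ → cliqueFn m ⌈(m : ℝ) ^ δ⌉₊ u = false →
          cdist Q u - ε = ∑ l, U u l * V l Q := by
  set N₀ : ℕ := ⌈1 / δ⌉₊ with hN₀
  filter_upwards [eventually_ceil_rpow_ge_and_mul_le hδ0 hδ1 (t + 8), eventually_le_ceil_rpow_pow hδ0]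
    with m hm hmk
  obtain ⟨hkB, hkm⟩ := hm
  intro ε hε L _ hL U V τ hτ hU hV hall
  classical
  -- sizes: `k = K + 1`, classes of size `t + 1`, block `M = K (t+1) ≤ (t+8) k ≤ m`
  set k : ℕ := ⌈(m : ℝ) ^ δ⌉₊ with hk
  set K : ℕ := k - 1 with hK
  have hkK : k = K + 1 := by omega
  have hK2 : 2 ≤ K := by omega
  have htK : t + 1 ≤ K := by omega
  set M : ℕ := K * (t + 1) with hM
  have hMle : M ≤ m := by
    have : K * (t + 1) ≤ (t + 8) * k := by rw [hkK]; nlinarith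
    omega
  have hpad : M + 0 ≤ m := by rw [add_zero]; exact hMle
  have hM8 : 8 < M := by nlinarith
  have h4t : 4 * (t + 1) ≤ M := by nlinarith
  -- `#L ≤ m^c ≤ k^{N₀ c} ≤ (K K)^{N₀ c} = K^{2 N₀ c} < K^{2 N₀ c + 1} ≤ K^{t+1} ≤ C(K (t+1), t+1) = C(M, t+1)`
  have hLM : Fintype.card L < M.choose (t + 1) := by
    have hkKK : k ≤ K * K := by rw [hkK]; nlinarith
    have h1 : m ^ c ≤ K ^ (2 * (N₀ * c)) := by
      calc m ^ c ≤ (k ^ N₀) ^ c := Nat.pow_le_pow_left hmk c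
        _ = k ^ (N₀ * c) := by rw [← pow_mul]
        _ ≤ (K * K) ^ (N₀ * c) := Nat.pow_le_pow_left hkKK _
        _ = K ^ (2 * (N₀ * c)) := by rw [← sq, ← pow_mul]
    have h2 : K ^ (2 * (N₀ * c)) < K ^ (2 * (N₀ * c) + 1) := Nat.pow_lt_pow_right (by omega) (Nat.lt_succ_self _)
    have h3 : K ^ (2 * (N₀ * c) + 1) ≤ K ^ (t + 1) := Nat.pow_le_pow_right (by omega) (by omega)
    have h4 : K ^ (t + 1) ≤ (K * (t + 1)).choose (t + 1) :=
      Literature.NumberTheory.Primality.SmoothLB.pow_le_choose_mul K (t + 1)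
    calc Fintype.card L ≤ m ^ c := hL
      _ < M.choose (t + 1) := lt_of_le_of_lt h1 (lt_of_lt_of_le h2 (h3.trans h4))
  -- the coloured block and its column
  set hb : Fin M → Fin K := balCol K (t + 1) with hhb
  have hbal : ∀ c, (cls hb c).card = t + 1 := card_cls_balCol K (t + 1)
  set u₀ : Edge m → Bool := padCol (m := m) 0 (colorVec hb) with hu₀
  have hu₀free : cliqueFn m k u₀ = false := by
    have := cliqueFn_padCol hpad (K := K + 1) (by omega) (colorVec hb) (cliqueFn_colorVec hb (Nat.lt_succ_self K))
    rw [hkK]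
    simpa using this
  -- the transported family on the block and its symmetry (the extensions fix every vertex `≥ M`)
  let ext : Equiv.Perm (Fin M) → Equiv.Perm (Fin m) := fun σ =>
    σ.extendDomain (Equiv.ofInjective (liveEmb hpad) (liveEmb hpad).injective)
  let VM : Finset (Fin M) → L → ℝ := fun P l => V l (P.map (liveEmb hpad))
  let τM : Equiv.Perm (Fin M) → L → L := fun σ => τ (ext σ)
  have hτM : ∀ σ l (P : Finset (Fin M)), VM (P.map σ.toEmbedding) (τM σ l) = VM P l := by
    intro σ l P
    show V (τ (ext σ) l) ((P.map σ.toEmbedding).map (liveEmb hpad)) = V l (P.map (liveEmb hpad))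
    rw [map_map_extendDomain hpad σ P]
    refine hτ (ext σ) (fun v hv => extendDomain_apply_of_le hpad σ ?_) l (P.map (liveEmb hpad))
    have : (k - 1) * (t + 1) = M := by rw [hM, hK]
    omega
  -- the identity restricted to the block
  have hrep : ∀ P : Finset (Fin M), P.card = K + 1 → cdist P (colorVec hb) - ε = ∑ l, U u₀ l * VM P l := by
    intro P hP
    have hQ : (padRow hpad P).card = k := by rw [card_padRow, hP, hkK]
    have h1 := hall (padRow hpad P) u₀ hQ hu₀free
    rw [hu₀, cdist_pad hpad P (colorVec hb)] at h1
    rw [← hu₀] at h1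
    rw [h1, padRow_zero hpad]
  exact cdist_colorVec_not_symmetricRep_small hb hbal ht2 htK le_rfl hM8 h4t hε hLM VM τM hτM
    (fun l P _ => hV l _) (fun l => U u₀ l) (fun l => hU u₀ l) hrep

/-! ## No LP gate symmetric on a block of `(k-1)(t+1)` vertices computes CLIQUE -/

/-- **No monotone LP gate that is symmetric on the first `(k-1)(t+1)` vertices computes `CLIQUE(m, ⌈m^δ⌉₊)` (every
`δ ∈ (0,1)`, every `c`, every `t ≥ max(2, 2⌈1/δ⌉(c+3))`).** Eventually in `m` (`k = ⌈m^δ⌉₊`): for all `p + q ≤ m^c`, all LP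
data `A, b, B ≥ 0`, and all homomorphisms `πp`, `πq` from the group of vertex permutations fixing every vertex `≥ (k-1)(t+1)`
to `Sym(p)`, `Sym(q)` that make the data invariant (`A_{πp σ i, πq σ j} = A_{ij}`, `b_{πp σ i} = b_i`, `B_{πp σ i, σ e} = B_{i,e}`),
the gate `x ↦ [∃ z ≥ 0, A z ≤ b + B x]` does not compute `CLIQUE(m, ⌈m^δ⌉₊)`: a monotone LP gate for CLIQUE must break the
symmetry of every vertex block of size `Θ_{c,δ}(m^δ)`. [new] -/
theorem symmetric_lpGate_blind_smallBlock {δ : ℝ} (hδ0 : 0 < δ) (hδ1 : δ < 1) (c t : ℕ) (ht2 : 2 ≤ t)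
    (hct : 2 * (⌈1 / δ⌉₊ * (c + 3)) ≤ t) :
    ∀ᶠ m : ℕ in atTop, ∀ (p q : ℕ), p + q ≤ m ^ c →
      ∀ (A : Fin p → Fin q → ℝ) (b : Fin p → ℝ) (B : Fin p → Edge m → ℝ), (∀ i e, 0 ≤ B i e) →
      ∀ (πp : fixingSubgroup (Equiv.Perm (Fin m)) {v : Fin m | (⌈(m : ℝ) ^ δ⌉₊ - 1) * (t + 1) ≤ v.val} →*
          Equiv.Perm (Fin p))
        (πq : fixingSubgroup (Equiv.Perm (Fin m)) {v : Fin m | (⌈(m : ℝ) ^ δ⌉₊ - 1) * (t + 1) ≤ v.val} →*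
          Equiv.Perm (Fin q)),
      (∀ σ i j, A (πp σ i) (πq σ j) = A i j) → (∀ σ i, b (πp σ i) = b i) →
      (∀ σ i e, B (πp σ i) ((SimpleGraph.Iso.completeGraph (σ : Equiv.Perm (Fin m))).mapEdgeSet e) = B i e) →
      ¬ ∀ x : Edge m → Bool, cliqueFn m ⌈(m : ℝ) ^ δ⌉₊ x = true ↔
          ∃ z : Fin q → ℝ, (∀ j, 0 ≤ z j) ∧ ∀ i, ∑ j, A i j * z j ≤ b i + ∑ e, B i e * (if x e then (1 : ℝ) else 0) := by
  filter_upwards [symmetric_cliqueDistConeRankHard_smallBlock hδ0 hδ1 (c + 3) t ht2 hct, Filter.eventually_ge_atTop 3]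
    with m hm hm3
  set G := fixingSubgroup (Equiv.Perm (Fin m)) {v : Fin m | (⌈(m : ℝ) ^ δ⌉₊ - 1) * (t + 1) ≤ v.val} with hG
  intro p q hpq A b B hB πp πq hA hb hBs hcomp
  classical
  obtain ⟨ε, hε, U, V, hU, hV, hfact, hsym⟩ := lpGate_cliqueDist_symmFactorisation A b B hB hcomp G πp πq
    (fun σ => (SimpleGraph.Iso.completeGraph (σ : Equiv.Perm (Fin m))).mapEdgeSet)
    (fun σ => (SimpleGraph.Iso.completeGraph (σ : Equiv.Perm (Fin m))).mapEdgeSet.bijective)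
    (fun σ Q e => cliqueVec_map_edgePerm (σ : Equiv.Perm (Fin m)) Q e) hA hb hBs
  have hE : Fintype.card (Edge m) ≤ m ^ 2 := card_edgeSet_top_le m
  have hcard : Fintype.card ((Fin p ⊕ Fin q) ⊕ ((Edge m ⊕ Edge m) ⊕ Unit)) ≤ m ^ (c + 3) := by
    simp only [Fintype.card_sum, Fintype.card_fin, Fintype.card_unit]
    have hm1 : 1 ≤ m := by omega
    have hc1 : 1 ≤ m ^ c := Nat.one_le_pow c m hm1
    have hcube : 2 * m ^ 2 + 2 ≤ m ^ 3 := by nlinarith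
    have h3 : m ^ (c + 3) = m ^ c * m ^ 3 := by ring
    have key : m ^ c + m ^ 3 ≤ m ^ c * m ^ 3 + 1 := by
      have hb1 : 1 ≤ m ^ 3 := Nat.one_le_pow 3 m hm1
      zify at hc1 hb1 ⊢
      nlinarith [mul_nonneg (sub_nonneg.2 hc1) (sub_nonneg.2 hb1)]
    omega
  refine hm ε hε ((Fin p ⊕ Fin q) ⊕ ((Edge m ⊕ Edge m) ⊕ Unit)) hcard U V
    (fun σ => if hσ : σ ∈ G then
      Sum.map (Sum.map (πp ⟨σ, hσ⟩) (πq ⟨σ, hσ⟩))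
        (Sum.map (Sum.map (SimpleGraph.Iso.completeGraph σ).mapEdgeSet (SimpleGraph.Iso.completeGraph σ).mapEdgeSet) id)
      else id)
    (fun σ hσfix l Q => ?_) hU hV ?_
  · have hσ : σ ∈ G := by
      rw [hG, mem_fixingSubgroup_iff]
      intro v hv
      exact hσfix v hv
    simp only [dif_pos hσ]
    exact hsym ⟨σ, hσ⟩ l Q
  · intro Q u hQ hu
    rw [← hfact Q u hQ hu]
    rfl

/-- **Registered helper stub (symmetric certificates blind for classes of size `t + 1`).** Restatement of
`cdist_colorVec_not_symmetricRep_small` with all parameters explicit. -/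
theorem symmetric_blind_small : ∀ {m K n t : ℕ} (h : Fin m → Fin K), (∀ c, (cls h c).card = n) → 2 ≤ t → t + 1 ≤ K → t + 1 ≤ n → 8 < m → 4 * (t + 1) ≤ m → ∀ (ε : ℝ), 0 < ε → ∀ {L : Type} [Fintype L], Fintype.card L < m.choose (t + 1) → ∀ (V : Finset (Fin m) → L → ℝ) (τ : Equiv.Perm (Fin m) → L → L), (∀ σ l Q, V (Q.map σ.toEmbedding) (τ σ l) = V Q l) → (∀ l Q, Q.card = K + 1 → 0 ≤ V Q l) → ∀ (c : L → ℝ), (∀ l, 0 ≤ c l) → ¬ ∀ Q : Finset (Fin m), Q.card = K + 1 → cdist Q (colorVec h) - ε = ∑ l, c l * V Q l := by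
  intro m K n t h hn ht2 htK htn hm8 h4t ε hε L _ hL V τ hτ hV0 c hc
  exact cdist_colorVec_not_symmetricRep_small h hn ht2 htK htn hm8 h4t hε hL V τ hτ hV0 c hc

/-- **Registered helper stub (the LP slice of the crux holds for families symmetric on `(k-1)(t+1)` vertices).** Restatement
of `symmetric_cliqueDistConeRankHard_smallBlock` with all parameters explicit. -/
theorem symmetric_crux_smallblock : ∀ (δ : ℝ), 0 < δ → δ < 1 → ∀ (c t : ℕ), 2 ≤ t → 2 * (⌈1 / δ⌉₊ * c) ≤ t → ∀ᶠ m : ℕ in Filter.atTop, ∀ ε : ℝ, 0 < ε → ∀ (L : Type) [Fintype L], Fintype.card L ≤ m ^ c → ∀ (U : (Edge m → Bool) → L → ℝ) (V : L → Finset (Fin m) → ℝ) (τ : Equiv.Perm (Fin m) → L → L), (∀ σ : Equiv.Perm (Fin m), (∀ v : Fin m, (⌈(m : ℝ) ^ δ⌉₊ - 1) * (t + 1) ≤ v.val → σ v = v) → ∀ l Q, V (τ σ l) (Q.map σ.toEmbedding) = V l Q) → (∀ u l, 0 ≤ U u l) → (∀ l Q, 0 ≤ V l Q) → ¬ ∀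 (Q : Finset (Fin m)) (u : Edge m → Bool), Q.card = ⌈(m : ℝ) ^ δ⌉₊ → cliqueFn m ⌈(m : ℝ) ^ δ⌉₊ u = false → cdist Q u - ε = ∑ l, U u l * V l Q := by
  intro δ hδ0 hδ1 c t ht2 hct
  exact symmetric_cliqueDistConeRankHard_smallBlock hδ0 hδ1 c t ht2 hct

/-- **Registered helper stub (no LP gate symmetric on `(k-1)(t+1)` vertices computes CLIQUE).** Restatement of
`symmetric_lpGate_blind_smallBlock` with all parameters explicit. -/
theorem symmetric_gate_smallblock : ∀ (δ : ℝ), 0 < δ → δ < 1 → ∀ (c t : ℕ), 2 ≤ t → 2 * (⌈1 / δ⌉₊ * (c + 3)) ≤ t → ∀ᶠ m : ℕ in Filter.atTop, ∀ (p q : ℕ), p + q ≤ m ^ c → ∀ (A : Fin p → Fin q → ℝ) (b : Fin p → ℝ) (B : Fin p → Edge m → ℝ), (∀ i e, 0 ≤ B i e) → ∀ (πp : fixingSubgroup (Equiv.Perm (Fin m)) {v : Fin m | (⌈(m : ℝ) ^ δ⌉₊ - 1) * (t + 1) ≤ v.val} →* Equiv.Perm (Fin p)) (πq : fixingSubgroup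 (Equiv.Perm (Fin m)) {v : Fin m | (⌈(m : ℝ) ^ δ⌉₊ - 1) * (t + 1) ≤ v.val} →* Equiv.Perm (Fin q)), (∀ σ i j, A (πp σ i) (πq σ j) = A i j) → (∀ σ i, b (πp σ i) = b i) → (∀ σ i e, B (πp σ i) ((SimpleGraph.Iso.completeGraph (σ : Equiv.Perm (Fin m))).mapEdgeSet e) = B i e) → ¬ ∀ x : Edge m → Bool, cliqueFn m ⌈(m : ℝ) ^ δ⌉₊ x = true ↔ ∃ z : Fin q → ℝ, (∀ j, 0 ≤ z j) ∧ ∀ i, ∑ j, A i j * z j ≤ b i + ∑ e, B i e * (if x e then (1 : ℝ) else 0) := by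
  intro δ hδ0 hδ1 c t ht2 hct
  exact symmetric_lpGate_blind_smallBlock hδ0 hδ1 c t ht2 hct

end

end Summit.PneNP.PneNP.Theorems
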